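import Summits.KontsevichZagierPeriods.KontsevichZagierPeriods.Theorems.LinRedNormalFormArrangementNormalFormStubSeparateZeroGapBound
import Summits.KontsevichZagierPeriods.KontsevichZagierPeriods.Theorems.LinRedNormalFormArrangementNormalFormStubSeparateZeroPieces

/-!
# Stub `stub_separateZero` (crux `ArrangementNormalForm`, line `janus-bands`) — part `PieceBound`

The pointwise bound on a GOOD piece (`abs_LB_le`): gap by gap via `gap_bound`, with the global
base majorant `Emaj S θ n y = (1 + ∑_{c,c'∈S} |c(y) − c'(y)|^{-θ})^n`; measurability of the data;
the finite set `Ybad` of base points where two distinct atoms agree.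
-/

noncomputable section

open Set MeasureTheory
open Literature.NumberTheory.Transcendental
open scoped ENNReal

namespace Summit.KontsevichZagierPeriods.ArrangementNormalForm.JanusBands

namespace SepZero

/-! ### The bound on a piece -/

variable {k : ℕ} {S : Finset Atom}

/-- The base majorant `(1 + ∑_{c,c' ∈ S} |c(y) − c'(y)|^{-θ})^n`. -/
def Emaj (S : Finset Atom) (θ : ℝ) (n : ℕ) (y : ℝ) : ℝ :=
  (1 + ∑ c ∈ S, ∑ c' ∈ S, |av c y - av c' y| ^ (-θ)) ^ n

/-- The double sum in `Emaj` is nonnegative. -/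
theorem Emaj_sum_nonneg (S : Finset Atom) (θ y : ℝ) :
    0 ≤ ∑ c ∈ S, ∑ c' ∈ S, |av c y - av c' y| ^ (-θ) :=
  Finset.sum_nonneg fun _ _ => Finset.sum_nonneg fun _ _ => Real.rpow_nonneg (abs_nonneg _) _

/-- A single term is bounded by the double sum. -/
theorem term_le_Emaj_sum {c c' : Atom} (hc : c ∈ S) (hc' : c' ∈ S) (θ y : ℝ) :
    |av c y - av c' y| ^ (-θ) ≤ ∑ c ∈ S, ∑ c' ∈ S, |av c y - av c' y| ^ (-θ) := by
  calc |av c y - av c' y| ^ (-θ) ≤ ∑ c'' ∈ S, |av c y - av c'' y| ^ (-θ) :=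
        Finset.single_le_sum (f := fun c'' => |av c y - av c'' y| ^ (-θ))
          (fun _ _ => Real.rpow_nonneg (abs_nonneg _) _) hc'
    _ ≤ ∑ c ∈ S, ∑ c' ∈ S, |av c y - av c' y| ^ (-θ) :=
        Finset.single_le_sum (f := fun c => ∑ c'' ∈ S, |av c y - av c'' y| ^ (-θ))
          (fun _ _ => Finset.sum_nonneg fun _ _ => Real.rpow_nonneg (abs_nonneg _) _) hc

/-- A piece is GOOD for the letters `a` if no bottom letter is literally its lower enclosing atom
and no top letter its upper enclosing atom. -/
def Good (a : Fin k → Option Atom) (π : Piece k S) : Prop :=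
  ∀ i c, a i = some c → (π.β i = i → c ≠ π.V i) ∧ (π.τ i = i → c ≠ π.W i)

variable {D : Set (Fin (1 + k) → ℝ)} {π : Piece k S} {z : Fin (1 + k) → ℝ}

/-- Facts about a coordinate `i` of the gap with bottom `b`. -/
theorem fiber_facts (hz : z ∈ pset D S π) {i b : Fin k} (hi : π.β i = b) :
    av (π.V b) (z (bo k)) = av (π.V i) (z (bo k)) ∧ av (π.W b) (z (bo k)) = av (π.W i) (z (bo k)) ∧
      π.β b = b ∧ π.τ i = π.τ b := by
  have hV : av (π.V b) (z (bo k)) = av (π.V i) (z (bo k)) := by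
    have := (hz.2.2.2.1 i).1; rwa [hi] at this
  refine ⟨hV, W_eq_of_V_eq hz hV, ?_, (hz.2.2.2.2.2 i b hV.symm).2⟩
  have := (beta_beta hz i).1; rwa [hi] at this

/-- **Pointwise bound on a good piece**, gap by gap via `gap_bound`. -/
theorem abs_LB_le (a : Fin k → Option Atom) (ha : ∀ i c, a i = some c → c ∈ S)
    (hz : z ∈ pset D S π) (hgood : Good a π)
    (hy : ∀ c ∈ S, ∀ c' ∈ S, c ≠ c' → av c (z (bo k)) ≠ av c' (z (bo k)))
    {θ cx Lw : ℝ} (hθ0 : 0 < θ) (hθ1 : θ ≤ 1) (hcx0 : 0 ≤ cx) (hcx1 : cx ≤ 1)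
    (hcard : (k : ℝ) * (1 - cx) + (1 - θ) ≤ cx)
    (hLw : ∀ i, av (π.W i) (z (bo k)) - av (π.V i) (z (bo k)) ≤ Lw) (h1Lw : 1 ≤ Lw) :
    |LB a z| ≤ Emaj S θ (2 * k) (z (bo k)) * Lw ^ k *
      ∏ i, omg cx ((z (fc i) - av (π.V i) (z (bo k))) /
        (av (π.W i) (z (bo k)) - av (π.V i) (z (bo k)))) /
        (av (π.W i) (z (bo k)) - av (π.V i) (z (bo k))) := by
  classical
  set y := z (bo k) with hydef
  set Sg := ∑ c ∈ S, ∑ c' ∈ S, |av c y - av c' y| ^ (-θ) with hSg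
  have hSg0 : 0 ≤ Sg := Emaj_sum_nonneg S θ y
  set P : Fin k → ℝ := fun i => omg cx ((z (fc i) - av (π.V i) y) /
    (av (π.W i) y - av (π.V i) y)) / (av (π.W i) y - av (π.V i) y) with hP
  set fib : Fin k → Finset (Fin k) := fun b => Finset.univ.filter (fun i => π.β i = b) with hfib
  -- the bound on one gap
  have hgap : ∀ b, ∏ i ∈ fib b, |(a i).elim 1 (fun c => 1 / (z (fc i) - av c y))| ≤
      (1 + Sg) ^ 2 * Lw ^ (fib b).card * ∏ i ∈ fib b, P i := by
    intro b
    by_cases hne : (fib b).Nonempty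
    swap
    · rw [Finset.not_nonempty_iff_eq_empty.1 hne]
      simp only [Finset.prod_empty, Finset.card_empty, pow_zero, mul_one]
      nlinarith
    obtain ⟨i₀, hi₀⟩ := hne
    have hi₀b : π.β i₀ = b := (Finset.mem_filter.1 hi₀).2
    obtain ⟨-, -, hbb, -⟩ := fiber_facts hz hi₀b
    have hmem : ∀ i, i ∈ fib b ↔ π.β i = b := fun i => by simp [hfib]
    set v := av (π.V b) y with hv
    set w := av (π.W b) y with hw
    have hvw : v < w := by have := hz.2.1 b; simp only [hv, hw]; linarith [this.1, this.2]
    have hτmem : π.τ b ∈ fib b := (hmem _).2 ((tau_tau hz b).1.trans hbb)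
    have hbmem : b ∈ fib b := (hmem b).2 hbb
    have hvals : ∀ i ∈ fib b, v = av (π.V i) y ∧ w = av (π.W i) y ∧ π.τ i = π.τ b := by
      intro i hi
      obtain ⟨hV, hW, -, hτ⟩ := fiber_facts hz ((hmem i).1 hi)
      exact ⟨hV, hW, hτ⟩
    have hcard' : ((fib b).card : ℝ) * (1 - cx) + (1 - θ) ≤ cx := by
      have h1 : ((fib b).card : ℝ) ≤ k := by
        have := Finset.card_le_univ (fib b)
        rw [Fintype.card_fin] at this
        exact_mod_cast this
      nlinarith
    have key := gap_bound (fib b) (fun i => z (fc i)) (fun i => (a i).map (fun c => av c y)) hvw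
      hbmem hτmem (fun i hi => ?_) (fun i hi => ?_) (fun i hi => ?_) (fun i hi c' hc' => ?_)
      (fun c' hc' hle => ?_) (fun c' hc' hle => ?_) hθ0 hθ1 hcx0 hcx1 hcard' (hLw b) h1Lw
    rotate_left
    · obtain ⟨hV, hW, -⟩ := hvals i hi
      rw [hV, hW]; exact hz.2.1 i
    · have := beta_le hz i
      rwa [(hmem i).1 hi] at this
    · have := le_tau hz i
      rwa [(hvals i hi).2.2] at this
    · obtain ⟨c, hc, rfl⟩ := Option.map_eq_some_iff.1 hc'
      obtain ⟨hV, hW, -⟩ := hvals i hi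
      rw [hV, hW]
      exact atom_outside hz i (ha i c hc)
    · obtain ⟨c, hc, rfl⟩ := Option.map_eq_some_iff.1 hc'
      have hne : c ≠ π.V b := (hgood b c hc).1 hbb
      exact lt_of_le_of_ne hle (hy c (ha b c hc) _ (π.V_mem b) hne)
    · obtain ⟨c, hc, rfl⟩ := Option.map_eq_some_iff.1 hc'
      have hne : c ≠ π.W (π.τ b) := (hgood (π.τ b) c hc).2 (tau_tau hz b).2
      have hw' : w = av (π.W (π.τ b)) y := (hvals _ hτmem).2.1
      rw [hw'] at hle ⊢
      exact lt_of_le_of_ne hle (hy c (ha _ c hc) _ (π.W_mem _) hne).symm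
    -- rewrite both sides of `key`
    have hlhs : ∀ i, |((a i).map (fun c => av c y)).elim 1 (fun c => 1 / (z (fc i) - c))| =
        |(a i).elim 1 (fun c => 1 / (z (fc i) - av c y))| := fun i => by cases a i <;> rfl
    simp only [hlhs] at key
    have hFA : ((a b).map (fun c => av c y)).elim 1 (fun c => 1 + |v - c| ^ (-θ)) ≤ 1 + Sg := by
      cases hab : a b with
      | none => simp only [Option.map_none, Option.elim]; linarith
      | some c =>
        simp only [Option.map_some, Option.elim]
        linarith [term_le_Emaj_sum (π.V_mem b) (ha b c hab) θ y]
    have hFB : ((a (π.τ b)).map (fun c => av c y)).elim 1 (fun c => 1 + |c - w| ^ (-θ)) ≤ 1 + Sg := by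
      cases hab : a (π.τ b) with
      | none => simp only [Option.map_none, Option.elim]; linarith
      | some c =>
        simp only [Option.map_some, Option.elim]
        linarith [term_le_Emaj_sum (ha _ c hab) (π.W_mem b) θ y]
    have hFB1 : 0 ≤ ((a (π.τ b)).map (fun c => av c y)).elim 1 (fun c => 1 + |c - w| ^ (-θ)) := by
      cases a (π.τ b) with
      | none => simp
      | some c => simpa using add_nonneg zero_le_one (Real.rpow_nonneg (abs_nonneg (av c y - w)) (-θ))
    have hPeq : ∏ i ∈ fib b, omg cx ((z (fc i) - v) / (w - v)) / (w - v) = ∏ i ∈ fib b, P i := by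
      refine Finset.prod_congr rfl fun i hi => ?_
      obtain ⟨hV, hW, -⟩ := hvals i hi
      simp only [hP, ← hV, ← hW]
    have hPge : 0 ≤ ∏ i ∈ fib b, P i := by
      rw [← hPeq]
      refine Finset.prod_nonneg fun i hi => div_nonneg (omg_nonneg _ ?_ ?_) (by linarith)
      · obtain ⟨hV, hW, -⟩ := hvals i hi
        have := hz.2.1 i; rw [← hV, ← hW] at this
        exact div_nonneg (by linarith [this.1]) (by linarith)
      · obtain ⟨hV, hW, -⟩ := hvals i hi
        have := hz.2.1 i; rw [← hV, ← hW] at this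
        rw [div_le_one (by linarith)]; linarith [this.2]
    rw [hPeq] at key
    refine key.trans ?_
    refine mul_le_mul_of_nonneg_right (mul_le_mul_of_nonneg_right ?_ (pow_nonneg (by linarith) _)) hPge
    rw [sq]
    exact mul_le_mul hFA hFB hFB1 (by linarith)
  -- assemble over the gaps
  have hL : |LB a z| = ∏ b, ∏ i ∈ fib b, |(a i).elim 1 (fun c => 1 / (z (fc i) - av c y))| := by
    rw [LB, Finset.abs_prod]
    exact (Finset.prod_fiberwise Finset.univ π.β _).symm
  have hR : ∏ i, P i = ∏ b, ∏ i ∈ fib b, P i := (Finset.prod_fiberwise Finset.univ π.β P).symm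
  have hLw' : Lw ^ k = ∏ b, Lw ^ (fib b).card := by
    rw [Finset.prod_pow_eq_pow_sum, ← Finset.card_eq_sum_card_fiberwise (fun i _ => Finset.mem_univ (π.β i)),
      Finset.card_univ, Fintype.card_fin]
  have hE : Emaj S θ (2 * k) y = ∏ _b : Fin k, (1 + Sg) ^ 2 := by
    rw [Finset.prod_const, Finset.card_univ, Fintype.card_fin, ← pow_mul, Emaj]
  change |LB a z| ≤ Emaj S θ (2 * k) y * Lw ^ k * ∏ i, P i
  rw [hL, hR, hLw', hE, ← Finset.prod_mul_distrib, ← Finset.prod_mul_distrib]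
  exact Finset.prod_le_prod (fun b _ => Finset.prod_nonneg fun i _ => abs_nonneg _) fun b _ => hgap b

/-! ### Measurability -/

/-- Atom values are measurable in `y`. -/
theorem measurable_av (c : Atom) : Measurable (av c) :=
  (measurable_const.mul measurable_id).add_const _

/-- Bound values are measurable in `z`. -/
theorem measurable_bv (u : Fin k ⊕ Atom) : Measurable fun z : Fin (1 + k) → ℝ => bv z u := by
  cases u with
  | inl j => exact measurable_pi_apply (fc j)
  | inr c => exact (measurable_av c).comp (measurable_pi_apply (bo k))

/-- The domain is measurable (for a measurable base set). -/
theorem measurableSet_dom {Yb : Set ℝ} (hYb : MeasurableSet Yb) (lo hi : Fin k → Fin k ⊕ Atom) :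
    MeasurableSet (dom Yb lo hi) := by
  have : dom Yb lo hi = {z | z (bo k) ∈ Yb} ∩ ⋂ i, ({z | bv z (lo i) < z (fc i)} ∩
      {z : Fin (1 + k) → ℝ | z (fc i) < bv z (hi i)}) := by
    ext z; simp [dom, mem_iInter]
  rw [this]
  refine (hYb.preimage (measurable_pi_apply _)).inter (MeasurableSet.iInter fun i => ?_)
  exact (measurableSet_lt (measurable_bv _) (measurable_pi_apply _)).inter
    (measurableSet_lt (measurable_pi_apply _) (measurable_bv _))

/-- A piece is measurable. -/
theorem measurableSet_pset {D : Set (Fin (1 + k) → ℝ)} (hD : MeasurableSet D) (π : Piece k S) :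
    MeasurableSet (pset D S π) := by
  have hV : ∀ i, Measurable fun z : Fin (1 + k) → ℝ => av (π.V i) (z (bo k)) := fun i =>
    (measurable_av _).comp (measurable_pi_apply _)
  have hW : ∀ i, Measurable fun z : Fin (1 + k) → ℝ => av (π.W i) (z (bo k)) := fun i =>
    (measurable_av _).comp (measurable_pi_apply _)
  have hq : ∀ q : Atom, Measurable fun z : Fin (1 + k) → ℝ => av q (z (bo k)) := fun q =>
    (measurable_av _).comp (measurable_pi_apply _)
  have ht : ∀ i, Measurable fun z : Fin (1 + k) → ℝ => z (fc i) := fun i => measurable_pi_apply _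
  have h1 : MeasurableSet {z : Fin (1 + k) → ℝ | ∀ i, av (π.V i) (z (bo k)) < z (fc i) ∧
      z (fc i) < av (π.W i) (z (bo k))} := by
    simp only [setOf_forall, setOf_and]
    exact MeasurableSet.iInter fun i => (measurableSet_lt (hV i) (ht i)).inter
      (measurableSet_lt (ht i) (hW i))
  have h2 : MeasurableSet {z : Fin (1 + k) → ℝ | ∀ i, ∀ q ∈ S, ¬ (av (π.V i) (z (bo k)) <
      av q (z (bo k)) ∧ av q (z (bo k)) < av (π.W i) (z (bo k)))} := by
    simp only [setOf_forall]
    refine MeasurableSet.iInter fun i => MeasurableSet.iInter fun q => MeasurableSet.iInter fun _ => ?_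
    exact ((measurableSet_lt (hV i) (hq q)).inter (measurableSet_lt (hq q) (hW i))).compl
  have h3 : MeasurableSet {z : Fin (1 + k) → ℝ | ∀ i, av (π.V (π.β i)) (z (bo k)) =
      av (π.V i) (z (bo k)) ∧ av (π.V (π.τ i)) (z (bo k)) = av (π.V i) (z (bo k))} := by
    simp only [setOf_forall, setOf_and]
    exact MeasurableSet.iInter fun i => (measurableSet_eq_fun (hV _) (hV _)).inter
      (measurableSet_eq_fun (hV _) (hV _))
  have h4 : MeasurableSet {z : Fin (1 + k) → ℝ | ∀ i, (π.β i = i ∨ z (fc (π.β i)) < z (fc i)) ∧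
      (π.τ i = i ∨ z (fc i) < z (fc (π.τ i)))} := by
    simp only [setOf_forall, setOf_and, setOf_or]
    exact MeasurableSet.iInter fun i => ((MeasurableSet.const _).union
      (measurableSet_lt (ht _) (ht _))).inter ((MeasurableSet.const _).union
      (measurableSet_lt (ht _) (ht _)))
  have h5 : MeasurableSet {z : Fin (1 + k) → ℝ | ∀ i j, av (π.V i) (z (bo k)) =
      av (π.V j) (z (bo k)) → π.β i = π.β j ∧ π.τ i = π.τ j} := by
    have : {z : Fin (1 + k) → ℝ | ∀ i j, av (π.V i) (z (bo k)) = av (π.V j) (z (bo k)) →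
        π.β i = π.β j ∧ π.τ i = π.τ j} = ⋂ i, ⋂ j, ({z | av (π.V i) (z (bo k)) =
        av (π.V j) (z (bo k))}ᶜ ∪ {_z | π.β i = π.β j ∧ π.τ i = π.τ j}) := by
      ext z; simp [mem_iInter, imp_iff_not_or]
    rw [this]
    exact MeasurableSet.iInter fun i => MeasurableSet.iInter fun j =>
      (measurableSet_eq_fun (hV _) (hV _)).compl.union (MeasurableSet.const _)
  have : pset D S π = D ∩ ({z | ∀ i, av (π.V i) (z (bo k)) < z (fc i) ∧
      z (fc i) < av (π.W i) (z (bo k))} ∩ ({z | ∀ i, ∀ q ∈ S, ¬ (av (π.V i) (z (bo k)) <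
      av q (z (bo k)) ∧ av q (z (bo k)) < av (π.W i) (z (bo k)))} ∩ ({z | ∀ i,
      av (π.V (π.β i)) (z (bo k)) = av (π.V i) (z (bo k)) ∧ av (π.V (π.τ i)) (z (bo k)) =
      av (π.V i) (z (bo k))} ∩ ({z | ∀ i, (π.β i = i ∨ z (fc (π.β i)) < z (fc i)) ∧
      (π.τ i = i ∨ z (fc i) < z (fc (π.τ i)))} ∩ {z | ∀ i j, av (π.V i) (z (bo k)) =
      av (π.V j) (z (bo k)) → π.β i = π.β j ∧ π.τ i = π.τ j})))) := by
    ext z; simp only [pset, mem_setOf_eq, mem_inter_iff]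
  rw [this]
  exact hD.inter (h1.inter (h2.inter (h3.inter (h4.inter h5))))

/-- The letter block is measurable. -/
theorem measurable_LB (a : Fin k → Option Atom) : Measurable (LB a : (Fin (1 + k) → ℝ) → ℝ) := by
  refine Finset.measurable_prod _ fun i _ => ?_
  cases a i with
  | none => exact measurable_const
  | some c => exact (measurable_const.div ((measurable_pi_apply _).sub
      ((measurable_av c).comp (measurable_pi_apply _))))

/-- `ω_c` is measurable. -/
theorem measurable_omg (c : ℝ) : Measurable (omg c) := by
  unfold omg
  exact measurable_const.mul ((measurable_id.pow_const _).add
    ((measurable_const.sub measurable_id).pow_const _))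

/-- The transported majorant is jointly measurable in `(y, t)` for measurable endpoints. -/
theorem measurable_psi (c : ℝ) {V W : ℝ → ℝ} (hV : Measurable V) (hW : Measurable W) :
    Measurable fun p : ℝ × ℝ => psi c (V p.1) (W p.1) p.2 := by
  have hVp : Measurable fun p : ℝ × ℝ => V p.1 := hV.comp measurable_fst
  have hWp : Measurable fun p : ℝ × ℝ => W p.1 := hW.comp measurable_fst
  have h : (fun p : ℝ × ℝ => psi c (V p.1) (W p.1) p.2) = fun p => if V p.1 < p.2 ∧ p.2 < W p.1
      then ENNReal.ofReal (omg c ((p.2 - V p.1) / (W p.1 - V p.1)) / (W p.1 - V p.1)) else 0 := by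
    funext p
    simp only [psi, indicator, mem_Ioo]
  rw [h]
  refine Measurable.ite ?_ ?_ measurable_const
  · exact (measurableSet_lt hVp measurable_snd).inter (measurableSet_lt measurable_snd hWp)
  · exact (((measurable_omg c).comp ((measurable_snd.sub hVp).div (hWp.sub hVp))).div
      (hWp.sub hVp)).ennreal_ofReal

/-- The base majorant is measurable. -/
theorem measurable_Emaj (S : Finset Atom) (θ : ℝ) (n : ℕ) : Measurable (Emaj S θ n) := by
  unfold Emaj
  refine (measurable_const.add (Finset.measurable_sum _ fun c _ =>
    Finset.measurable_sum _ fun c' _ => ?_)).pow_const _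
  exact ((measurable_av c).sub (measurable_av c')).abs.pow_const _

/-! ### The exceptional base points -/

/-- Base points where two distinct atoms of `S` take the same value. -/
def Ybad (S : Finset Atom) : Set ℝ := {y | ∃ c ∈ S, ∃ c' ∈ S, c ≠ c' ∧ av c y = av c' y}

/-- Distinct atoms agree at most at one point. -/
theorem subsingleton_setOf_av_eq {c c' : Atom} (h : c ≠ c') : ({y : ℝ | av c y = av c' y}).Subsingleton := by
  intro y hy y' hy'
  simp only [mem_setOf_eq, av] at hy hy'
  by_cases hs : c.1 0 = c'.1 0
  · exfalso
    apply h
    have h2 : (c.2 : ℝ) = c'.2 := by rw [hs] at hy; linarith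
    refine Prod.ext (funext fun i => ?_) (by exact_mod_cast h2)
    rw [Subsingleton.elim i 0]; exact hs
  · have hs' : (c.1 0 : ℝ) - c'.1 0 ≠ 0 := by
      intro h0; apply hs; exact_mod_cast (sub_eq_zero.1 h0)
    have e1 : ((c.1 0 : ℝ) - c'.1 0) * y = c'.2 - c.2 := by linarith
    have e2 : ((c.1 0 : ℝ) - c'.1 0) * y' = c'.2 - c.2 := by linarith
    exact mul_left_cancel₀ hs' (e1.trans e2.symm)

/-- `Ybad S` is finite. -/
theorem finite_Ybad (S : Finset Atom) : (Ybad S).Finite := by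
  have : Ybad S ⊆ ⋃ c ∈ S, ⋃ c' ∈ S, {y | c ≠ c' ∧ av c y = av c' y} := by
    intro y hy
    obtain ⟨c, hc, c', hc', hne, he⟩ := hy
    simp only [mem_iUnion, mem_setOf_eq]
    exact ⟨c, hc, c', hc', hne, he⟩
  refine Set.Finite.subset (Set.Finite.biUnion S.finite_toSet fun c _ =>
    Set.Finite.biUnion S.finite_toSet fun c' _ => ?_) this
  by_cases h : c = c'
  · simp [h]
  · exact ((subsingleton_setOf_av_eq h).anti fun y hy => hy.2).finite

/-- `Ybad S` is measurable and null. -/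
theorem volume_Ybad (S : Finset Atom) : MeasurableSet (Ybad S) ∧ volume (Ybad S) = 0 :=
  ⟨(finite_Ybad S).measurableSet, (finite_Ybad S).measure_zero _⟩

/-- Off `Ybad`, distinct atoms have distinct values. -/
theorem av_ne_of_notMem_Ybad {y : ℝ} (hy : y ∉ Ybad S) :
    ∀ c ∈ S, ∀ c' ∈ S, c ≠ c' → av c y ≠ av c' y :=
  fun c hc c' hc' hne he => hy ⟨c, hc, c', hc', hne, he⟩

end SepZero

/-- Registered support goal of this file: the exceptional base points form a finite set. -/
theorem separateZero_pieceBound (S : Finset SepZero.Atom) : (SepZero.Ybad S).Finite :=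
  SepZero.finite_Ybad S

end Summit.KontsevichZagierPeriods.ArrangementNormalForm.JanusBands
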